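import Mathlib
import Summits.Ventures.PercRepro.TriangleCapTwoTrianglesC

/-!
# PercRepro — towards the cell `(7, 11)`: the two-triangle case when a triangle has an outer vertex, and the
far matching edge of two vertex-disjoint triangles (p3, gen 35; part 35g)

At `k = 7` the chain `(k − 6)|T₃| + 2·Σ_{T₃}|outer| + 3·Σ_{codeg = 0} deficit ≥ 6(k − 2) = 30` needs, with two
triangles (`|T₃| = 12`), `2·Σ|outer| + 3·Σ₀ ≥ 18` — tight on the census maximisers.  This module gives the two
cheap halves, for every `k`:

* `four_le_sum_codeg_zero_of_two` — one `codeg = 0` pair with deficit `≥ 2` gives `Σ₀ ≥ 4`;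
* `twelve_le_sum_outer` — a vertex outer for both triangles contributes `12` to `Σ_{T₃}|outer|`;
* **`outer_bound`** — if a vertex `x` off `S` is outer for the first triangle then `2·Σ|outer| + 3·Σ₀ ≥ 24`:
  either `x` is outer for the second triangle too (`Σ|outer| ≥ 12`), or `x` is adjacent to a vertex `t` of it,
  the pair `(x, t)` has `codeg = 0` (`x` lies on no triangle) and its deficit contains the two vertices of the
  first triangle not adjacent to `t` (`Σ₀ ≥ 4`);
* **`six_le_of_disjoint_no_outer`** — two vertex-disjoint triangles with no outer vertex: a vertex `r` off `S`
  has exactly one neighbour `t₁`, `t₂` in each; every vertex `p ≠ t₁` of the first triangle has a neighbour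
  `μ(p)` in the second, and one of the two has `μ(p) ≠ t₂` (two vertices of the first triangle cannot share
  `t₂`); the pairs `(r, t₁)`, `(r, t₂)`, `(p, μ(p))` have `codeg = 0` and deficits `≥ 1` (the third contains `r`),
  so `Σ₀ ≥ 6`.

Axioms: standard.
-/

namespace PercRepro

namespace TriangleCap

namespace C047

open Finset

variable {V : Type*} [Fintype V] [DecidableEq V]

/-- One `codeg = 0` pair with deficit at least `2` gives `Σ_{codeg = 0} deficit ≥ 4`. -/
theorem four_le_sum_codeg_zero_of_two (D : SimpleGraph V) [DecidableRel D.Adj] {x t : V}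
    (hxt : D.Adj x t) (hc : codeg D (x, t) = 0) (hd : 2 ≤ deficit D (x, t)) :
    4 ≤ ∑ p ∈ adjPairsAll D, (if codeg D p = 0 then deficit D p else 0) := by
  set P : Finset (V × V) := {(x, t), (t, x)} with hP
  have hsub : P ⊆ adjPairsAll D := by
    intro p hp
    rw [hP] at hp
    simp only [mem_insert, mem_singleton] at hp
    rw [mem_adjPairsAll]
    rcases hp with rfl | rfl
    · exact hxt
    · exact hxt.symm
  have hc' : codeg D (t, x) = 0 := by rw [codeg_comm]; exact hc
  have hd' : 2 ≤ deficit D (t, x) := by rw [deficit_comm]; exact hd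
  have hpos : ∀ p ∈ P, 2 ≤ (if codeg D p = 0 then deficit D p else 0) := by
    intro p hp
    rw [hP] at hp
    simp only [mem_insert, mem_singleton] at hp
    rcases hp with rfl | rfl
    · rw [if_pos hc]; exact hd
    · rw [if_pos hc']; exact hd'
  have hcard : P.card = 2 := by
    rw [hP, card_insert_of_notMem, card_singleton]
    simp [hxt.ne]
  calc 4 = ∑ _p ∈ P, 2 := by rw [sum_const, hcard, smul_eq_mul]
    _ ≤ ∑ p ∈ P, (if codeg D p = 0 then deficit D p else 0) := sum_le_sum hpos
    _ ≤ ∑ p ∈ adjPairsAll D, (if codeg D p = 0 then deficit D p else 0) := sum_le_sum_of_subset hsub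

/-- A vertex outer for both triangles contributes `12` to `Σ_{T₃} |outer|`. -/
theorem twelve_le_sum_outer (D : SimpleGraph V) [DecidableRel D.Adj] {u v w a b c x : V}
    (huv : D.Adj u v) (huw : D.Adj u w) (hvw : D.Adj v w) (hab : D.Adj a b) (hac : D.Adj a c)
    (hbc : D.Adj b c) (ha : ¬ (a = u ∨ a = v ∨ a = w)) (hx1 : x ∈ outer D u v w)
    (hx2 : x ∈ outer D a b c) :
    12 ≤ ∑ t ∈ triangles3 D, (outer D t.1.1 t.1.2 t.2).card := by
  have hx1' := (mem_outer D u v w x).mp hx1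
  have hx2' := (mem_outer D a b c x).mp hx2
  have hau : a ≠ u := fun h => ha (Or.inl h)
  have hav : a ≠ v := fun h => ha (Or.inr (Or.inl h))
  have haw : a ≠ w := fun h => ha (Or.inr (Or.inr h))
  have huv' := huv.ne
  have huw' := huw.ne
  have hvw' := hvw.ne
  have hab' := hab.ne
  have hac' := hac.ne
  have hbc' := hbc.ne
  set P : Finset ((V × V) × V) :=
    {((u, v), w), ((v, w), u), ((w, u), v), ((v, u), w), ((u, w), v), ((w, v), u),
      ((a, b), c), ((b, c), a), ((c, a), b), ((b, a), c), ((a, c), b), ((c, b), a)} with hP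
  have hsub : P ⊆ triangles3 D := by
    intro t ht
    rw [hP] at ht
    simp only [mem_insert, mem_singleton] at ht
    rw [mem_triangles3]
    rcases ht with rfl | rfl | rfl | rfl | rfl | rfl | rfl | rfl | rfl | rfl | rfl | rfl
    · exact ⟨huv, huw, hvw⟩
    · exact ⟨hvw, huv.symm, huw.symm⟩
    · exact ⟨huw.symm, hvw.symm, huv⟩
    · exact ⟨huv.symm, hvw, huw⟩
    · exact ⟨huw, huv, hvw.symm⟩
    · exact ⟨hvw.symm, huw.symm, huv.symm⟩
    · exact ⟨hab, hac, hbc⟩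
    · exact ⟨hbc, hab.symm, hac.symm⟩
    · exact ⟨hac.symm, hbc.symm, hab⟩
    · exact ⟨hab.symm, hbc, hac⟩
    · exact ⟨hac, hab, hbc.symm⟩
    · exact ⟨hbc.symm, hac.symm, hab.symm⟩
  have hpos : ∀ t ∈ P, 1 ≤ (outer D t.1.1 t.1.2 t.2).card := by
    intro t ht
    rw [hP] at ht
    simp only [mem_insert, mem_singleton] at ht
    apply card_pos.mpr
    refine ⟨x, ?_⟩
    rcases ht with rfl | rfl | rfl | rfl | rfl | rfl | rfl | rfl | rfl | rfl | rfl | rfl <;>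
      (rw [mem_outer]; tauto)
  have hcard : P.card = 12 := by
    rw [hP, card_insert_of_notMem, card_insert_of_notMem, card_insert_of_notMem,
      card_insert_of_notMem, card_insert_of_notMem, card_insert_of_notMem, card_insert_of_notMem,
      card_insert_of_notMem, card_insert_of_notMem, card_insert_of_notMem, card_insert_of_notMem,
      card_singleton]
    all_goals simp [huv', huw', hvw', hab', hac', hbc', huv'.symm, huw'.symm, hvw'.symm,
      hab'.symm, hac'.symm, hbc'.symm, hau.symm, hav.symm, haw.symm]
  calc 12 = ∑ _t ∈ P, 1 := by rw [sum_const, hcard]; rfl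
    _ ≤ ∑ t ∈ P, (outer D t.1.1 t.1.2 t.2).card := sum_le_sum hpos
    _ ≤ ∑ t ∈ triangles3 D, (outer D t.1.1 t.1.2 t.2).card := sum_le_sum_of_subset hsub

/-- **AN OUTER VERTEX OF THE FIRST TRIANGLE:** `2·Σ_{T₃}|outer| + 3·Σ_{codeg = 0} deficit ≥ 24`. -/
theorem outer_bound (D : SimpleGraph V) [DecidableRel D.Adj] (hK : K4mFree D) {u v w a b c x : V}
    (huv : D.Adj u v) (huw : D.Adj u w) (hvw : D.Adj v w) (hab : D.Adj a b) (hac : D.Adj a c)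
    (hbc : D.Adj b c) (ha : ¬ (a = u ∨ a = v ∨ a = w))
    (hS : ∀ x y z, D.Adj x y → D.Adj x z → D.Adj y z → x = u ∨ x = v ∨ x = w ∨ x = a ∨ x = b ∨ x = c)
    (hx : x ∈ outer D u v w) (hxS : ¬ (x = u ∨ x = v ∨ x = w ∨ x = a ∨ x = b ∨ x = c)) :
    24 ≤ 2 * ∑ t ∈ triangles3 D, (outer D t.1.1 t.1.2 t.2).card +
      3 * ∑ p ∈ adjPairsAll D, (if codeg D p = 0 then deficit D p else 0) := by
  have h6 := six_le_sum_outer D huv huw hvw hx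
  have hx' := (mem_outer D u v w x).mp hx
  by_cases hx2 : x ∈ outer D a b c
  · have := twelve_le_sum_outer D huv huw hvw hab hac hbc ha hx hx2
    omega
  · have hadj := adj_of_not_outer D hx2
    have hno : ∀ y z, D.Adj x y → D.Adj x z → D.Adj y z → False :=
      fun y z h1 h2 h3 => hxS (hS x y z h1 h2 h3)
    have hx2' : ¬ (x = a ∨ x = b ∨ x = c) := fun h => hxS (or6_of_or3_right h)
    -- the neighbour `t` of `x` in the second triangle and the two vertices of the first triangle it misses
    have key : ∀ t, (t = a ∨ t = b ∨ t = c) → D.Adj t x →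
        4 ≤ ∑ p ∈ adjPairsAll D, (if codeg D p = 0 then deficit D p else 0) := by
      intro t ht hxt
      have ht1 : ¬ (t = u ∨ t = v ∨ t = w) := by
        rcases ht with rfl | rfl | rfl
        · exact ha
        · rintro (h | h | h) <;> subst h
          · exact hx'.1 hxt
          · exact hx'.2.1 hxt
          · exact hx'.2.2 hxt
        · rintro (h | h | h) <;> subst h
          · exact hx'.1 hxt
          · exact hx'.2.1 hxt
          · exact hx'.2.2 hxt
      obtain ⟨g1, g2, g3⟩ := at_most_one_of_triangle D hK huv huw hvw ht1
      have hc : codeg D (x, t) = 0 := codeg_eq_zero_of_no_triangle D hxt.symm hno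
      -- two of `u, v, w` are adjacent to neither `x` nor `t`
      have hd : 2 ≤ deficit D (x, t) := by
        unfold deficit
        have hsub : ∀ S : Finset V, S ⊆ univ.filter (fun y => ¬ D.Adj x y ∧ ¬ D.Adj t y) →
            S.card ≤ (univ.filter (fun y => ¬ D.Adj x y ∧ ¬ D.Adj t y)).card :=
          fun S h => card_le_card h
        by_cases htu : D.Adj t u
        · have htv : ¬ D.Adj t v := fun h => g1 ⟨htu.symm, h.symm⟩
          have htw : ¬ D.Adj t w := fun h => g2 ⟨htu.symm, h.symm⟩
          refine le_trans ?_ (hsub {v, w} ?_)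
          · rw [card_pair hvw.ne]
          · intro y hy
            simp only [mem_insert, mem_singleton] at hy
            simp only [mem_filter, mem_univ, true_and]
            rcases hy with rfl | rfl
            · exact ⟨fun h => hx'.2.1 h.symm, htv⟩
            · exact ⟨fun h => hx'.2.2 h.symm, htw⟩
        · by_cases htv : D.Adj t v
          · have htw : ¬ D.Adj t w := fun h => g3 ⟨htv.symm, h.symm⟩
            refine le_trans ?_ (hsub {u, w} ?_)
            · rw [card_pair huw.ne]
            · intro y hy
              simp only [mem_insert, mem_singleton] at hy
              simp only [mem_filter, mem_univ, true_and]
              rcases hy with rfl | rfl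
              · exact ⟨fun h => hx'.1 h.symm, htu⟩
              · exact ⟨fun h => hx'.2.2 h.symm, htw⟩
          · refine le_trans ?_ (hsub {u, v} ?_)
            · rw [card_pair huv.ne]
            · intro y hy
              simp only [mem_insert, mem_singleton] at hy
              simp only [mem_filter, mem_univ, true_and]
              rcases hy with rfl | rfl
              · exact ⟨fun h => hx'.1 h.symm, htu⟩
              · exact ⟨fun h => hx'.2.1 h.symm, htv⟩
      exact four_le_sum_codeg_zero_of_two D hxt.symm hc hd
    rcases hadj with h | h | h
    · have := key a (by simp) h; omega
    · have := key b (by simp) h; omega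
    · have := key c (by simp) h; omega

end C047

end TriangleCap

end PercRepro
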